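import Literature.Combinatorics.Optimization.PatternMatrixPsdRank
import HarnessLib

/-!
# The separating functional `L_D`: Lee–Raghavendra–Steurer 2015 §3 (psd rank vs sos degree), typed,
# and Theorem 3.8 DERIVED from Theorem 3.1

Eighth file of the tree's Lee–Raghavendra–Steurer story.  `PatternMatrixPsdRank.lean` vendors the
engine of all the tree's LRS psd-rank lower bounds as ONE named fact,
`LeeRaghavendraSteurer2015_thm38` (Thm 3.8, quantitative part), and says "the proof (Thm 3.1 …,
psd-factorisation scaling, density-matrix approximation by quantum entropy) is not reproduced".
This file TYPES that printed architecture — LRS §3 "PSD rank and sum-of-squares degree" — so that the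
engine fact is itself derived from the paper's "main technical theorem":

* definitions (§3.1, p. 14): the uniform average `E_{S,x}` over `m`-subsets `S ⊆ [n]` and `x ∈ {0,1}ⁿ`
  (`subsetCubeExpect`), the restriction `x_S` (`cubeRestrict`), the **separating functional**
  `L_D(N) = E_x E_S D(x_S) N(S,x)` (`sepFunctional`), `‖N‖₁ = E_{S,x} N(S,x)` (`entryAverage`),
  the squared Frobenius norm (`frobSq`) and the uniform density matrix `𝕀 = Id/Tr Id`
  (`uniformDensity`);
* PROVED plumbing: `Σ_x g(x_S) = 2^{n−m} Σ_y g(y)` (`sum_comp_cubeRestrict`), hence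
  `L_D(M_n^f) = E_x D(x) f(x)` (`sepFunctional_patternMatrix`, the display before eq. (3.1), p. 11:
  "`L_D(M_n^f) = E_{|S|=m} E_x D(x_S)·f(x_S) < −ε`") and `‖M_n^f‖₁ = E f`
  (`entryAverage_patternMatrix`, p. 17: "Note that `‖M^f_n‖₁ = E f`");
* NAMED FACTS (not proved here), verbatim up to the rendering decisions below:
  `LeeRaghavendraSteurer2015_thm31` (Thm 3.1 "Strengthening", with its explicit `α`),
  `LeeRaghavendraSteurer2015_thm33` (Thm 3.3 "psd factorization scaling"),
  `LeeRaghavendraSteurer2015_thm35` (Thm 3.5 = Thm 3.2 "Degree reduction");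
* PROVED: **`LeeRaghavendraSteurer2015_thm38_of_thm31 : _thm31 → _thm38`** — the printed proof of
  Thm 3.8 (p. 17: "One observes that `L_D(M^f_n) < −ε`. … (eq:quantitative) follows directly from
  Thm 3.1"), with `c = C`.

So after this file the LRS layer (Thm 1.1, Cor 1.2 cut/TSP/STAB, Thm 1.5 printed form, 1.6, 6.4,
all derived from `_thm38` in the sibling files) rests on `LeeRaghavendraSteurer2015_thm31`; the
printed proof of Thm 3.1 (p. 15–16) is Thm 3.3 + Thm 3.4 (density matrix approximation = Thm 4.1,
§4, to be typed with §4) + Thm 3.5 + bookkeeping.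

Rendering decisions.  (i) `rk_psd(N)` enters Thm 3.1 only through the monotone hypothesis
"`rk_psd(N)²/‖N‖₁ ≤ α (n/log n)^{d/2}`", rendered "for every `r` with a size-`r` psd factorisation
and `r² ≤ α (n/log n)^{d/2} ‖N‖₁`" (equivalent: take `r = rk_psd(N)`, resp. `rk_psd(N) ≤ r`; for
`‖N‖₁ = 0`, i.e. `N = 0`, the conclusion `L_D(N) ≥ −ε` holds trivially); in Thm 3.3 `r = rk_psd(M)`
is rendered by "`M` has a psd factorisation of size `r` and none of smaller size".  (ii) `‖D‖_∞`
enters through any bound `K ≥ |D|` (all printed bounds are antitone in `‖D‖_∞`, as in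
`LeeRaghavendraSteurer2015_thm38`); `‖M‖_∞` in Thm 3.3 through any `Δ ≥ max M` and
`max_S ‖A(S)²‖` in Thm 3.5 through any `τ` with `A(S)² ⪯ τ·Id` (for psd matrices `‖X‖ ≤ τ ⟺ X ⪯ τ Id`;
larger `Δ`, `τ` only weaken the conclusions, so each rendered statement is implied by the printed
one).  (iii) Operator-norm bounds on psd matrices are Loewner bounds (`‖P_i‖ ≤ c` ⟺ `P_i ⪯ c·Id`),
`‖B‖_*` of a psd matrix is its trace.  (iv) Thm 3.5's printed range "`m, d, ℓ ≤ n`" includes `m = n`,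
where the printed right-hand side `(ℓm/(n−m))^{d/4}` is a division by zero (the bound is vacuous in
print); we require `m < n` — a recorded guard, not a change of content (Thm 3.1 uses `n ≥ 2m`).
(v) `log` is `Real.log`; the base only rescales the universal constant `C`.  (vi) `(n/log n)^{d/2}`
etc. use `Real.rpow`.

NOT here: Thm 3.4 (= Thm 4.1, §4: density matrix approximation; needs quantum relative entropy),
Lemmas 3.6/3.7 (internal to the printed proof of Thm 3.5), the first part of Thm 3.8
(`1 + n^{1+d/2} ≥ rk_psd ≥ C_f (n/log n)^{d/4}`, see the sibling file's note), and the observation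
"`L_D(N) ≥ 0` for factorizations through squares of degree `≤ d/2`" (p. 14).

Source: J. R. Lee, P. Raghavendra, D. Steurer, *Lower bounds on the size of semidefinite programming
relaxations*, STOC 2015 [LeeRaghavendraSteurer2015]; held text `paper:arxiv-1411.6317`: §2 (p. 11:
`L_D`, Lemma 2.1, `𝕀`), §3.1 Thm 3.1–3.4 (p. 14–15), proof of Thm 3.1 (p. 15–16), §3.2 Thm 3.5
(p. 16), §3.3 Thm 3.8 and its proof (p. 17).
-/

noncomputable section

open Finset Matrix
open scoped MatrixOrder

namespace Literature.Combinatorics.Optimization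

/-! ### `E_{S,x}`, the restriction `x_S`, the functional `L_D`, `‖N‖₁` -/

/-- The restriction `x_S ∈ {0,1}^m` of `x ∈ {0,1}ⁿ` to an `m`-subset `S` (coordinates in increasing
order), so that `M_n^f(S,x) = f(x_S)`. [cite: LeeRaghavendraSteurer2015, §1 (eq. (restriction))] -/
def cubeRestrict {n m : ℕ} (S : {S : Finset (Fin n) // S.card = m}) (x : Fin n → Bool) :
    Fin m → Bool :=
  fun j => x (S.1.orderEmbOfFin S.2 j)

/-- The uniform average `E_{S,x} g(S,x)` over `m`-subsets `S ⊆ [n]` and `x ∈ {0,1}ⁿ` ("the expectation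
over `S` is a uniform average over all `S ⊆ [n]` with `|S| = m`"). (For `m > n` there are no such `S`
and the value is the junk `0`; all uses have `n ≥ 2m`.) [cite: LeeRaghavendraSteurer2015, §3.1 (p. 14)] -/
def subsetCubeExpect (n m : ℕ) (g : {S : Finset (Fin n) // S.card = m} → (Fin n → Bool) → ℝ) : ℝ :=
  (∑ S, ∑ x, g S x) / ((Fintype.card {S : Finset (Fin n) // S.card = m} : ℝ) * 2 ^ n)

/-- **The separating functional** `L_D(N) = E_x E_S D(x_S) N(S,x)` of a pseudo-density
`D : {0,1}^m → ℝ` on matrices `N : C([n],m) × {0,1}ⁿ → ℝ`. [cite: LeeRaghavendraSteurer2015, §3.1 (p. 14, display (L_D))] -/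
def sepFunctional {n m : ℕ} (D : (Fin m → Bool) → ℝ)
    (N : {S : Finset (Fin n) // S.card = m} → (Fin n → Bool) → ℝ) : ℝ :=
  subsetCubeExpect n m fun S x => D (cubeRestrict S x) * N S x

/-- `‖N‖₁ = E_{S,x} N(S,x)`, the average entry. [cite: LeeRaghavendraSteurer2015, §3.1 (p. 14: "‖N‖₁ = E_{S,x} N(S,x)")] -/
def entryAverage {n m : ℕ} (N : {S : Finset (Fin n) // S.card = m} → (Fin n → Bool) → ℝ) : ℝ :=
  subsetCubeExpect n m N

/-- The squared Frobenius norm `‖X‖_F² = Σ_{ij} X_{ij}² = Tr(Xᵀ X)`. [cite: LeeRaghavendraSteurer2015, §3.2 (p. 16: "for any symmetric matrix A, ‖A‖_F² = Tr(A²)")] -/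
def frobSq {p q : ℕ} (X : Matrix (Fin p) (Fin q) ℝ) : ℝ := ∑ i, ∑ j, X i j ^ 2

/-- The uniform density matrix `𝕀 = Id / Tr(Id)` of dimension `r`. [cite: LeeRaghavendraSteurer2015, §3.1 (p. 14: "Recall that 𝕀 = Id/Tr(Id) is the uniform density matrix")] -/
def uniformDensity (r : ℕ) : Matrix (Fin r) (Fin r) ℝ := (1 / (r : ℝ)) • 1

/-! ### `x_S` is uniformly distributed: `Σ_x g(x_S) = 2^{n−m} Σ_y g(y)` -/

/-- Summing a function of the restriction `x_S` over the big cube counts every point of the small cube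
`2^{n−m}` times. [cite: LeeRaghavendraSteurer2015, §2 (p. 11, display before eq. (3.1): E_{|S|=m} E_x D(x_S) f(x_S))] -/
theorem sum_comp_cubeRestrict {n m : ℕ} (S : {S : Finset (Fin n) // S.card = m})
    (g : (Fin m → Bool) → ℝ) :
    ∑ x : Fin n → Bool, g (cubeRestrict S x) = 2 ^ (n - m) * ∑ y, g y := by
  classical
  -- split the coordinates of `x` into those in `S` and the others
  let E := Equiv.piEquivPiSubtypeProd (fun i : Fin n => i ∈ S.1) (fun _ => Bool)
  -- reindex the `S`-coordinates by `Fin m` along the increasing enumeration of `S`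
  let e : {i // i ∈ S.1} ≃ Fin m := (S.1.orderIsoOfFin S.2).toEquiv.symm
  let ψ : ({i // i ∈ S.1} → Bool) ≃ (Fin m → Bool) := Equiv.piCongrLeft' (fun _ => Bool) e
  have hψ : ∀ x : Fin n → Bool, cubeRestrict S x = ψ (E x).1 := fun x => rfl
  have hcard : Fintype.card ({i // i ∉ S.1} → Bool) = 2 ^ (n - m) := by
    rw [Fintype.card_fun, Fintype.card_bool, Fintype.card_subtype_compl, Fintype.card_fin,
      Fintype.card_coe, S.2]
  calc ∑ x : Fin n → Bool, g (cubeRestrict S x)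
      = ∑ x : Fin n → Bool, g (ψ (E x).1) := by simp_rw [hψ]
    _ = ∑ p : ({i // i ∈ S.1} → Bool) × ({i // i ∉ S.1} → Bool), g (ψ p.1) :=
        Fintype.sum_equiv E _ _ fun x => rfl
    _ = ∑ a : {i // i ∈ S.1} → Bool, ∑ _b : {i // i ∉ S.1} → Bool, g (ψ a) :=
        Fintype.sum_prod_type _
    _ = ∑ a : {i // i ∈ S.1} → Bool, (2 ^ (n - m) : ℝ) * g (ψ a) := by
        refine Finset.sum_congr rfl fun a _ => ?_
        rw [Finset.sum_const, nsmul_eq_mul, Finset.card_univ, hcard]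
        push_cast
        ring
    _ = 2 ^ (n - m) * ∑ a : {i // i ∈ S.1} → Bool, g (ψ a) := by rw [Finset.mul_sum]
    _ = 2 ^ (n - m) * ∑ y, g y := by rw [Fintype.sum_equiv ψ _ _ fun a => rfl]

/-- The number of `m`-subsets of `[n]`. [folklore] -/
private theorem card_subsets (n m : ℕ) :
    Fintype.card {S : Finset (Fin n) // S.card = m} = n.choose m := by
  rw [Fintype.card_finset_len, Fintype.card_fin]

/-- Averaging a function of `x_S`: `E_{S,x} g(x_S) = E_y g(y)` for `m ≤ n`.
[cite: LeeRaghavendraSteurer2015, §2 (p. 11, display before eq. (3.1))] -/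
theorem subsetCubeExpect_comp_cubeRestrict {n m : ℕ} (hmn : m ≤ n) (g : (Fin m → Bool) → ℝ) :
    subsetCubeExpect n m (fun S x => g (cubeRestrict S x)) = cubeExpect g := by
  unfold subsetCubeExpect cubeExpect
  simp_rw [sum_comp_cubeRestrict]
  rw [Finset.sum_const, Finset.card_univ, nsmul_eq_mul]
  have hc : (Fintype.card {S : Finset (Fin n) // S.card = m} : ℝ) ≠ 0 := by
    rw [card_subsets]; exact_mod_cast (Nat.choose_pos hmn).ne'
  have h2 : (2 : ℝ) ^ n = 2 ^ (n - m) * 2 ^ m := by rw [← pow_add, Nat.sub_add_cancel hmn]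
  rw [h2]
  field_simp

/-- **`L_D(M_n^f) = E_x D(x) f(x)`** (`m ≤ n`): the functional of `D` evaluated at the pattern matrix
of `f` is the correlation of `D` with `f`. [cite: LeeRaghavendraSteurer2015, §2 (p. 11: "L_D(M_n^f) = E_{|S|=m} E_x D(x_S)·f(x_S) < −ε") and Thm 3.8 proof (p. 17: "One observes that L_D(M^f_n) < −ε")] -/
theorem sepFunctional_patternMatrix {n m : ℕ} (hmn : m ≤ n) (D f : (Fin m → Bool) → ℝ) :
    sepFunctional D (patternMatrix n f) = cubeExpect (fun y => D y * f y) := by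
  unfold sepFunctional
  exact subsetCubeExpect_comp_cubeRestrict hmn (fun y => D y * f y)

/-- **`‖M_n^f‖₁ = E f`** (`m ≤ n`). [cite: LeeRaghavendraSteurer2015, Thm 3.8 proof (p. 17: "Note that ‖M^f_n‖₁ = E f")] -/
theorem entryAverage_patternMatrix {n m : ℕ} (hmn : m ≤ n) (f : (Fin m → Bool) → ℝ) :
    entryAverage (patternMatrix n f) = cubeExpect f := by
  unfold entryAverage
  exact subsetCubeExpect_comp_cubeRestrict hmn f

/-! ### The named facts of §3 -/

/-- **Lee–Raghavendra–Steurer 2015, Theorem 3.1 (Strengthening of Thm 2.3; "main technical theorem").**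
"For every `m, d ≥ 1`, every `ε ∈ (0,1]`, and every degree-`d` pseudo-density `D : {0,1}^m → ℝ`,
there exists a number `α > 0` such that whenever `n ≥ 2m` and a nonnegative matrix
`N : C([n],m) × {0,1}ⁿ → ℝ` satisfies `‖N‖_∞ ≤ 1`, `(1/‖N‖₁) rk_psd(N)² ≤ α (n/log n)^{d/2}`, we have
`L_D(N) ≥ −ε`.  Moreover, this holds for `α = (C ε/(d m² ‖D‖_∞))^{d/2} (ε/‖D‖_∞)³` where `C > 0` is
a universal constant."  Rendered (module docstring (i),(ii),(v)): `‖D‖_∞` through any `K ≥ |D|`,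
`rk_psd(N)` through any factorisation size `r` with `r² ≤ α (n/log n)^{d/2} ‖N‖₁`.  NOT proved here
(printed proof: Thm 3.3 + Thm 3.4 + Thm 3.5, p. 15–16). [cite: LeeRaghavendraSteurer2015, Thm. 3.1 (p. 14)] -/
def LeeRaghavendraSteurer2015_thm31 : Prop :=
  ∃ C : ℝ, 0 < C ∧
    ∀ (m d : ℕ), 1 ≤ m → 1 ≤ d →
    ∀ (ε : ℝ), 0 < ε → ε ≤ 1 →
    ∀ (D : (Fin m → Bool) → ℝ) (K : ℝ), IsPseudoDensity d D → (∀ x, |D x| ≤ K) →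
    ∀ n : ℕ, 2 * m ≤ n →
    ∀ N : {S : Finset (Fin n) // S.card = m} → (Fin n → Bool) → ℝ,
      (∀ S x, 0 ≤ N S x ∧ N S x ≤ 1) →
    ∀ r : ℕ, HasPsdFactorization N r →
      (r : ℝ) ^ 2 ≤ (C * ε / (d * (m : ℝ) ^ 2 * K)) ^ ((d : ℝ) / 2) * (ε / K) ^ 3 *
          ((n : ℝ) / Real.log n) ^ ((d : ℝ) / 2) * entryAverage N →
      -ε ≤ sepFunctional D N

/-- **Lee–Raghavendra–Steurer 2015, Theorem 3.3 (psd factorization scaling).**  "For every nonnegative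
matrix `M ∈ ℝ^{p×q}` and every `η ∈ (0,1]`, there exist psd matrices `{P_i}_{i∈[p]}`, `{Q_j}_{j∈[q]}`
with: (1) `M_{ij} ≤ Tr(P_i Q_j) ≤ M_{ij} + η‖M‖_∞`; (2) `(1/p) Σ_i P_i = Id`;
(3) `‖P_i‖ ≤ 2 rk_psd(M)²/η`; (4) `Q_j ⪯ ‖M‖_∞ (η + rk_psd(M)²) rk_psd(M) · 𝕀`."  Rendered (module
docstring (i)–(iii)): `r = rk_psd(M)` as "a size-`r` factorisation exists and none smaller", the
psd matrices `P_i, Q_j` have some common (unprinted) dimension `k` and `𝕀 = Id_k/k`, `‖M‖_∞` through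
any `Δ ≥ max M`, `‖P_i‖ ≤ c` as `P_i ⪯ c·Id`, and (2) as `Σ_i P_i = p·Id`.  NOT proved here (printed
proof p. 14–15, in dimension `k = r`, from Lemma 2.1 = Briët–Dadush–Pokutta rescaling, of which the
tree holds only the weak form `HasPsdFactorization.rescale_weak`). [cite: LeeRaghavendraSteurer2015, Thm. 3.3 (p. 14)] -/
def LeeRaghavendraSteurer2015_thm33 : Prop :=
  ∀ (ι κ : Type) [Fintype ι] [Fintype κ] [Nonempty ι] (M : ι → κ → ℝ) (Δ : ℝ),
    (∀ i j, 0 ≤ M i j ∧ M i j ≤ Δ) →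
  ∀ (η : ℝ), 0 < η → η ≤ 1 →
  ∀ (r : ℕ), HasPsdFactorization M r → (∀ r', HasPsdFactorization M r' → r ≤ r') →
    ∃ (k : ℕ) (P : ι → Matrix (Fin k) (Fin k) ℝ) (Q : κ → Matrix (Fin k) (Fin k) ℝ),
      (∀ i, (P i).PosSemidef) ∧ (∀ j, (Q j).PosSemidef) ∧
      (∀ i j, M i j ≤ (P i * Q j).trace ∧ (P i * Q j).trace ≤ M i j + η * Δ) ∧
      (∑ i, P i = (Fintype.card ι : ℝ) • (1 : Matrix (Fin k) (Fin k) ℝ)) ∧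
      (∀ i, P i ≤ (2 * (r : ℝ) ^ 2 / η) • (1 : Matrix (Fin k) (Fin k) ℝ)) ∧
      (∀ j, Q j ≤ (Δ * (η + (r : ℝ) ^ 2) * r) • uniformDensity k)

/-- **Lee–Raghavendra–Steurer 2015, Theorem 3.5 (= Thm 3.2, Degree reduction).**  "Let positive integers
`n ≥ 1` and `m, d, ℓ ≤ n` be given.  Suppose `A : C([n],m) → ℝ^{p×p}` and `B : {0,1}ⁿ → ℝ^{p×p}` are
two functions taking symmetric matrices as values.  Let `D : {0,1}^m → ℝ` be a degree-`d`
pseudo-density and suppose that `deg(B) ≤ ℓ`.  Then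
`E_{S,x} D(x_S) ‖A(S)B(x)‖_F² ≥ −2‖D‖_∞ (ℓm/(n−m))^{d/4} (max_S ‖A(S)²‖)^{1/2}
(E_{S,x} ‖A(S)B(x)‖_F²)^{1/2} (E_x ‖B(x)‖_F²)^{1/2}`."  Rendered (module docstring (ii),(iv)): `‖D‖_∞`
through any `K ≥ |D|`, `max_S ‖A(S)²‖` through any `τ` with `A(S)² ⪯ τ·Id` for all `S`, `deg(B) ≤ ℓ`
entrywise (`HasDegreeLE ℓ` of every entry, the paper's footnote definition), "positive integers"
`m, d, ℓ ≥ 1`, and `m < n` (the printed `m ≤ n` allows a vacuous division by zero).  NOT proved here (printed proof: Lemmas 3.6, 3.7, p. 16–17,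
Fourier analysis of matrix-valued functions). [cite: LeeRaghavendraSteurer2015, Thm. 3.5 (p. 16) (= Thm. 3.2, p. 14)] -/
def LeeRaghavendraSteurer2015_thm35 : Prop :=
  ∀ (n m d ℓ p : ℕ), 1 ≤ n → 1 ≤ m → m < n → 1 ≤ d → d ≤ n → 1 ≤ ℓ → ℓ ≤ n →
  ∀ (A : {S : Finset (Fin n) // S.card = m} → Matrix (Fin p) (Fin p) ℝ)
    (B : (Fin n → Bool) → Matrix (Fin p) (Fin p) ℝ),
    (∀ S, (A S).IsSymm) → (∀ x, (B x).IsSymm) → (∀ i j, HasDegreeLE ℓ fun x => B x i j) →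
  ∀ (D : (Fin m → Bool) → ℝ) (K : ℝ), IsPseudoDensity d D → (∀ x, |D x| ≤ K) →
  ∀ τ : ℝ, (∀ S, A S * A S ≤ τ • (1 : Matrix (Fin p) (Fin p) ℝ)) →
    -(2 * K * (((ℓ : ℝ) * m) / ((n : ℝ) - m)) ^ ((d : ℝ) / 4) * Real.sqrt τ *
        Real.sqrt (subsetCubeExpect n m fun S x => frobSq (A S * B x)) *
        Real.sqrt (cubeExpect fun x => frobSq (B x)))
      ≤ subsetCubeExpect n m fun S x => D (cubeRestrict S x) * frobSq (A S * B x)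

/-! ### Theorem 3.8 from Theorem 3.1 -/

/-- A pseudo-density with `|D| ≤ K` pointwise forces `K > 0` (as `E D = 1`). [cite: LeeRaghavendraSteurer2015, §2 (pseudo-densities: E_x D(x) = 1)] -/
theorem IsPseudoDensity.bound_pos {m d : ℕ} {D : (Fin m → Bool) → ℝ} {K : ℝ}
    (hD : IsPseudoDensity d D) (hK : ∀ x, |D x| ≤ K) : 0 < K := by
  by_contra hK0
  push Not at hK0
  have hz : ∀ x, D x = 0 := fun x => abs_nonpos_iff.1 ((hK x).trans hK0)
  have h1 := hD.1
  unfold cubeExpect at h1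
  simp [hz] at h1

/-- **Lee–Raghavendra–Steurer 2015, Theorem 3.8 DERIVED from Theorem 3.1** (the printed proof, p. 17):
for `N = M_n^f` one has `‖N‖_∞ ≤ 1`, `‖N‖₁ = E f` and `L_D(N) = E_x D(x) f(x) < −ε`, so by (the
contrapositive of) Thm 3.1 every psd factorisation of `M_n^f` has size `r` with
`r² > α (n/log n)^{d/2} E f`, `α = (Cε/(dm²‖D‖_∞))^{d/2}(ε/‖D‖_∞)³`, i.e.
`r ≥ (Cεn/(dm²‖D‖_∞ log n))^{d/4} (ε/‖D‖_∞)^{3/2} √(E f)`; the universal constant of Thm 3.8 is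
`c = C`. [cite: LeeRaghavendraSteurer2015, Thm. 3.8 and its proof (p. 17)] -/
theorem LeeRaghavendraSteurer2015_thm38_of_thm31 (h31 : LeeRaghavendraSteurer2015_thm31) :
    LeeRaghavendraSteurer2015_thm38 := by
  obtain ⟨C, hC, H⟩ := h31
  refine ⟨C, hC, fun m d hm hd f hf ε hε hε1 D K hD hK hDf n hn r hr hfac => ?_⟩
  have hmn : m ≤ n := by omega
  have hK0 : 0 < K := hD.bound_pos hK
  have hn2 : (2 : ℝ) ≤ n := by exact_mod_cast (show 2 ≤ n by omega)
  have hlog : 0 < Real.log n := Real.log_pos (by linarith)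
  have hEf : 0 ≤ cubeExpect f := cubeExpect_nonneg fun x => (hf x).1
  -- the quantities
  set a : ℝ := C * ε / (d * (m : ℝ) ^ 2 * K) with ha
  set b : ℝ := (n : ℝ) / Real.log n with hb
  have ha0 : 0 ≤ a := by rw [ha]; positivity
  have hb0 : 0 ≤ b := by rw [hb]; positivity
  have hεK : 0 ≤ ε / K := by positivity
  -- the bound of Thm 3.8 squared is the bound of Thm 3.1 times `‖M‖₁ = E f`
  have hsq : ((C * ε * n / (d * (m : ℝ) ^ 2 * K * Real.log n)) ^ ((d : ℝ) / 4) *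
        (ε / K) ^ ((3 : ℝ) / 2) * Real.sqrt (cubeExpect f)) ^ 2 =
      a ^ ((d : ℝ) / 2) * (ε / K) ^ 3 * b ^ ((d : ℝ) / 2) * cubeExpect f := by
    have hab : C * ε * n / (d * (m : ℝ) ^ 2 * K * Real.log n) = a * b := by
      rw [ha, hb]; field_simp
    have h1 : ((a * b) ^ ((d : ℝ) / 4)) ^ 2 = (a * b) ^ ((d : ℝ) / 2) := by
      rw [← Real.rpow_natCast, ← Real.rpow_mul (mul_nonneg ha0 hb0)]
      norm_num
      ring_nf
    have h2 : ((ε / K) ^ ((3 : ℝ) / 2)) ^ 2 = (ε / K) ^ 3 := by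
      rw [← Real.rpow_natCast ((ε / K) ^ ((3 : ℝ) / 2)), ← Real.rpow_mul hεK]
      norm_num
    rw [hab, mul_pow, mul_pow, Real.sq_sqrt hEf, h1, h2, Real.mul_rpow ha0 hb0]
    ring
  -- hence the hypothesis of Thm 3.1 holds for `N = M_n^f`
  have hr2 : (r : ℝ) ^ 2 ≤ a ^ ((d : ℝ) / 2) * (ε / K) ^ 3 * b ^ ((d : ℝ) / 2) *
      entryAverage (patternMatrix n f) := by
    rw [entryAverage_patternMatrix hmn, ← hsq]
    have h0 : (0 : ℝ) ≤ r := Nat.cast_nonneg r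
    nlinarith [hr, h0]
  have hN : ∀ S x, 0 ≤ patternMatrix n f S x ∧ patternMatrix n f S x ≤ 1 := fun S x => hf _
  have key := H m d hm hd ε hε hε1 D K hD hK n hn (patternMatrix n f) hN r hfac hr2
  rw [sepFunctional_patternMatrix hmn] at key
  linarith

end Literature.Combinatorics.Optimization

end
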